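import Mathlib
import HarnessLib
import Literature.NumberTheory.Transcendental.KZCalculus
import Literature.NumberTheory.Transcendental.KZProduct
import Summits.KontsevichZagierPeriods.KontsevichZagierPeriods.Theorems.LinRedNormalFormDihedralNormalFormStubBvStokes
import Summits.KontsevichZagierPeriods.KontsevichZagierPeriods.Theorems.LinRedNormalFormDihedralNormalFormStubBoundedStokesMove
import Summits.KontsevichZagierPeriods.KontsevichZagierPeriods.Theorems.LinRedNormalFormDihedralNormalFormStubExactToFacesOne
import Summits.KontsevichZagierPeriods.KontsevichZagierPeriods.Theorems.LinRedNormalFormDihedralNormalFormStubExactToFacesTwo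
import Summits.KontsevichZagierPeriods.KontsevichZagierPeriods.Theorems.LinRedNormalFormDihedralNormalFormStubCellZetaMovesLow

/-!
# Line `tame-bv-stokes` (crux `DihedralNormalForm`): the cubical normal form through dimension two

Support theorem for the crux `DihedralNormalForm` (stmt-KontsevichZagierPeriods-3912, route
`LinRedNormalForm`), line `tame-bv-stokes`, lineage b: the composition of the landed stubs
`stub_exactToFacesOne`, `stub_exactToFacesTwo` (with `stub_boundedStokesMove stub_bvStokes`) and
`stub_cellZetaMovesLow` in dimensions `k ≤ 2`. Every ABSOLUTELY CONVERGENT cubical representation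
`[(0,1)ᵏ, q · xᵃ · ∏_{i ≤ j} (1 - xᵢ⋯xⱼ)^{e i j}]` (`a ∈ ℤᵏ`, `e ∈ ℤ`) of dimension `k ≤ 2` is
congruent modulo `KZ.relations` — i.e. by finitely many instances of Kontsevich–Zagier's rules
(1) additivity, (2) change of variables, (3) Newton–Leibniz with absolutely convergent
intermediates — to a `ℤ`-combination of MZV word representations `[Δ_w, q' · ∏ ω_{εᵢ}(tᵢ)]`
(here: the empty word = rational constants, and the `ζ(2)` word). Examples: `∫∫ dx dy/(1-xy)` is
the `ζ(2)` word itself (one change of variables), `∫∫ x dx dy/(1-xy) ≡ [pt, 1]` (two bounded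
Stokes moves), `∫∫ (1-y) dx dy/(1-xy)² ≡ [pt, 1]`.

This is the `k ≤ 2` instance of the node `CubRep k ⊆ relations ⊔ closure WordRep` of the line's
composition (`Cruxes/DihedralNormalForm/Lines/tame-bv-stokes.lean`, `logRep_cubRep_subset_RW`);
together with the shared entrance stub `stub_atomReduction` (line `torus-descent-sum-shadow`) at
`k ≤ 2` it gives the crux for `M_{0,4}` and `M_{0,5}`.

References: M. Kontsevich, D. Zagier, *Periods* (2001), §1.2; F. Brown, *Multiple zeta values and
periods of moduli spaces* `M_{0,n}`, Ann. Sci. ÉNS 42 (2009), §2, §7; F. Brown, S. Carr, L. Schneps,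
*The algebra of cell-zeta values*, Compos. Math. 146 (2010), §4.4.
-/

noncomputable section

open MeasureTheory Set

namespace Summit.KontsevichZagierPeriods.DihedralNormalForm.TameBVStokes

open Literature.NumberTheory.Transcendental

/-- **Cubical normal form through dimension two.** For `k ≤ 2`, every absolutely convergent
cubical representation `[(0,1)ᵏ, q · xᵃ · ∏_{i≤j}(1 - xᵢ⋯xⱼ)^{e i j}]` with integer exponents lies
in `KZ.relations ⊔ closure (MZV word representations)`: dimension `0` is the empty word, dimension
`1` is one Newton–Leibniz move to a rational constant (`stub_exactToFacesOne`), dimension `2` is the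
pole-order induction with bounded primitives of `stub_exactToFacesTwo` followed by the residue
classification `stub_cellZetaMovesLow` of the convergent logarithmic forms of `M_{0,5}` (only the
`ζ(2)` form survives). -/
theorem stub_cubicalNormalFormLowDim : ∀ (k : ℕ), k ≤ 2 → ∀ y ∈ {y : Literature.NumberTheory.Transcendental.KZ.FormalRep | ∃ (q : ℚ) (a : Fin k → ℤ) (e : Fin k → Fin k → ℤ) (s : Literature.NumberTheory.Transcendental.KZ.IntegralRep k), s.domain = {x : Fin k → ℝ | ∀ i, x i ∈ Set.Ioo (0:ℝ) 1} ∧ Set.EqOn s.integrand (fun x => (q : ℝ) * ((∏ i, x i ^ a i) * ∏ i, ∏ j, if i ≤ j then (1 - ∏ l, if i ≤ l ∧ l ≤ j then x l else 1) ^ e i j else 1)) s.domain ∧ y = Literature.NumberTheory.Transcendental.KZ.of s}, y ∈ Literature.NumberTheory.Transcendental.KZ.relations ⊔ AddSubgroup.closure {x : Literature.NumberTheory.Transcendental.KZ.FormalRep | ∃ (w : ℕ) (ε : Fin w → Bool) (q : ℚ) (s : Literature.NumberTheory.Transcendental.KZ.IntegralRep w), s.domain = {t : Fin w → ℝ | (∀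 i, 0 < t i) ∧ (∀ i, t i < 1) ∧ StrictAnti t} ∧ Set.EqOn s.integrand (fun t => (q : ℝ) * ∏ i, if ε i then 1 / (1 - t i) else 1 / t i) s.domain ∧ x = Literature.NumberTheory.Transcendental.KZ.of s} := by
  -- the parametrised generator families of the line, as set-valued functions
  set CubRep : ℕ → Set KZ.FormalRep := fun k => {y : Literature.NumberTheory.Transcendental.KZ.FormalRep | ∃ (q : ℚ) (a : Fin k → ℤ) (e : Fin k → Fin k → ℤ) (s : Literature.NumberTheory.Transcendental.KZ.IntegralRep k), s.domain = {x : Fin k → ℝ | ∀ i, x i ∈ Set.Ioo (0:ℝ) 1} ∧ Set.EqOn s.integrand (fun x => (q : ℝ) * ((∏ i, x i ^ a i) * ∏ i, ∏ j, if i ≤ j then (1 - ∏ l, if i ≤ l ∧ l ≤ j then x l else 1) ^ e i j else 1)) s.domain ∧ y = Literature.NumberTheory.Transcendental.KZ.of s} with hCubRep_def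
  set LogRep : ℕ → Set KZ.FormalRep := fun ℓ => {y : Literature.NumberTheory.Transcendental.KZ.FormalRep | ∃ (q : (Fin ℓ → Fin (ℓ + 2)) → ℚ) (s : Literature.NumberTheory.Transcendental.KZ.IntegralRep ℓ), s.domain = {t : Fin ℓ → ℝ | (∀ i, 0 < t i) ∧ (∀ i, t i < 1) ∧ StrictAnti t} ∧ Set.EqOn s.integrand (fun t => ∑ f : Fin ℓ → Fin (ℓ + 2), (q f : ℝ) * ∏ i : Fin ℓ, 1 / (t i - (if ((f i : Fin (ℓ + 2)) : ℕ) = 0 then (0:ℝ) else if ((f i : Fin (ℓ + 2)) : ℕ) = 1 then 1 else if h : ((f i : Fin (ℓ + 2)) : ℕ) - 2 < (i : ℕ) then t ⟨((f i : Fin (ℓ + 2)) : ℕ) - 2, lt_trans h i.isLt⟩ else 0))) s.domain ∧ y = Literature.NumberTheory.Transcendental.KZ.of s} with hLogRep_def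
  set W : Set KZ.FormalRep := {x : Literature.NumberTheory.Transcendental.KZ.FormalRep | ∃ (w : ℕ) (ε : Fin w → Bool) (q : ℚ) (s : Literature.NumberTheory.Transcendental.KZ.IntegralRep w), s.domain = {t : Fin w → ℝ | (∀ i, 0 < t i) ∧ (∀ i, t i < 1) ∧ StrictAnti t} ∧ Set.EqOn s.integrand (fun t => (q : ℝ) * ∏ i, if ε i then 1 / (1 - t i) else 1 / t i) s.domain ∧ x = Literature.NumberTheory.Transcendental.KZ.of s} with hW_def
  have hC : ∀ k, CubRep k = {y : Literature.NumberTheory.Transcendental.KZ.FormalRep | ∃ (q : ℚ) (a : Fin k → ℤ) (e : Fin k → Fin k → ℤ) (s : Literature.NumberTheory.Transcendental.KZ.IntegralRep k), s.domain = {x : Fin k → ℝ | ∀ i, x i ∈ Set.Ioo (0:ℝ) 1} ∧ Set.EqOn s.integrand (fun x => (q : ℝ) * ((∏ i, x i ^ a i) * ∏ i, ∏ j, if i ≤ j then (1 - ∏ l, if i ≤ l ∧ l ≤ j then x l else 1) ^ e i j else 1)) s.domain ∧ y = Literature.NumberTheory.Transcendental.KZ.of s} := fun _ => rfl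
  have hL : ∀ ℓ, LogRep ℓ = {y : Literature.NumberTheory.Transcendental.KZ.FormalRep | ∃ (q : (Fin ℓ → Fin (ℓ + 2)) → ℚ) (s : Literature.NumberTheory.Transcendental.KZ.IntegralRep ℓ), s.domain = {t : Fin ℓ → ℝ | (∀ i, 0 < t i) ∧ (∀ i, t i < 1) ∧ StrictAnti t} ∧ Set.EqOn s.integrand (fun t => ∑ f : Fin ℓ → Fin (ℓ + 2), (q f : ℝ) * ∏ i : Fin ℓ, 1 / (t i - (if ((f i : Fin (ℓ + 2)) : ℕ) = 0 then (0:ℝ) else if ((f i : Fin (ℓ + 2)) : ℕ) = 1 then 1 else if h : ((f i : Fin (ℓ + 2)) : ℕ) - 2 < (i : ℕ) then t ⟨((f i : Fin (ℓ + 2)) : ℕ) - 2, lt_trans h i.isLt⟩ else 0))) s.domain ∧ y = Literature.NumberTheory.Transcendental.KZ.of s} := fun _ => rfl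
  -- the target subgroup
  have hRW : KZ.relations ≤ KZ.relations ⊔ AddSubgroup.closure W := le_sup_left
  -- dimension 0: a cubical representation of dimension 0 is the empty word
  have h0 : CubRep 0 ⊆ ((KZ.relations ⊔ AddSubgroup.closure W : AddSubgroup KZ.FormalRep) : Set KZ.FormalRep) := by
    rintro y ⟨q, a, e, s, hdom, hint, rfl⟩
    refine (le_sup_right : AddSubgroup.closure W ≤ _) (AddSubgroup.subset_closure ⟨0, Fin.elim0, q, s, ?_, ?_, rfl⟩)
    · rw [hdom]
      ext t
      simp only [Set.mem_setOf_eq, IsEmpty.forall_iff, true_and]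
      exact ⟨fun _ => fun i => i.elim0, fun _ => trivial⟩
    · intro t ht
      rw [hint ht]
      simp
  -- dimension 1: one Newton–Leibniz move
  have h1 : CubRep 1 ⊆ ((KZ.relations ⊔ AddSubgroup.closure W : AddSubgroup KZ.FormalRep) : Set KZ.FormalRep) := by
    intro y hy
    have h := stub_exactToFacesOne CubRep hC y hy
    have hle : AddSubgroup.closure (CubRep 0) ≤ KZ.relations ⊔ AddSubgroup.closure W := by
      rw [AddSubgroup.closure_le]; exact h0
    exact (sup_le hRW hle) h
  -- the convergent logarithmic forms of `M_{0,5}`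
  have hlog2 : LogRep 2 ⊆ ((KZ.relations ⊔ AddSubgroup.closure W : AddSubgroup KZ.FormalRep) : Set KZ.FormalRep) :=
    fun y hy => stub_cellZetaMovesLow LogRep hL 2 le_rfl y hy
  -- dimension 2: bounded Stokes moves down to the logarithmic forms and to dimension 1
  have h2 : CubRep 2 ⊆ ((KZ.relations ⊔ AddSubgroup.closure W : AddSubgroup KZ.FormalRep) : Set KZ.FormalRep) := by
    intro y hy
    have h := stub_exactToFacesTwo CubRep hC LogRep hL (stub_boundedStokesMove stub_bvStokes) y hy
    have hle : AddSubgroup.closure (LogRep 2 ∪ CubRep 1) ≤ KZ.relations ⊔ AddSubgroup.closure W := by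
      rw [AddSubgroup.closure_le]; exact Set.union_subset hlog2 h1
    exact (sup_le hRW hle) h
  -- assemble
  intro k hk y hy
  interval_cases k
  · exact h0 hy
  · exact h1 hy
  · exact h2 hy

end Summit.KontsevichZagierPeriods.DihedralNormalForm.TameBVStokes
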